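import Summits.BirchSwinnertonDyer.BirchSwinnertonDyer.Theorems.SmallImageMuTransferMuTransferStubCm
import Summits.BirchSwinnertonDyer.BirchSwinnertonDyer.Theorems.Rank1ResidualX9CMPartner
import Literature.NumberTheory.EllipticCurves.EmertonPollackWeston2006.MuAnTransferGoodOrdinary
import HarnessLib

/-!
# K6 crux `AnalyticMuZeroX9NoCMPartner` (stmt-BirchSwinnertonDyer-19235): the analytic `μ = 0`
# certificate is a `ρ̄`-INVARIANT — one certificate per mod-`p` congruence class (judge note (d))

Cell `bsd-smallim`, seat `bsd-smallim-koly` (gen 6). HONEST FRAMING: theorems only (no definition, no new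
named fact, D-0026); nothing is booked and no count moves; CONDITIONAL helper (`--supports`) of item
19235 carrying its published inputs as explicit fact binders.

The K6 tribunal judge (PASS tier B, note (d), 2026-08-26T04:18Z) recorded: "`AnalyticMuZeroX9NoCMPartner`
is Greenberg's conjecture on infinitely many `ρ̄` — per-`ρ̄` deletions bankable, the class-wide item never
closes that way". This file puts the "per-`ρ̄`" clause in the kernel: for two globally minimal curves
`W, W'` over `ℚ`, both good ORDINARY at a prime `p ≥ 5`, with `W[p]` irreducible and a `Γ_ℚ`-equivariant
isomorphism `W[p] ≃ W'[p]`, the crux-shaped certificate "some coefficient of `L_p(f, α_W)` is a `p`-adic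
unit" for ONE newform `f` of `W` (any level) implies the same for EVERY newform `f'` of `W'` (any level)
— `certificate_of_torsionIso`. So on class X9 the analytic `μ = 0` input (`AnalyticMuZeroOnClassX9`,
its children 19234/19235) is decided congruence class by congruence class: ONE exact modular-symbol
certificate per `ρ̄` (`analyticCertificate_classX9_of_torsionIso`), modulo the cite-only facts below.

Inputs (binders; all cite-only facts of the K6 cone): `hEPW` — Emerton–Pollack–Weston, Invent. Math.
163 (2006) Thm. 1, `∗ = an` (`EmertonPollackWeston2006.thm1_muAn_transfer_of_torsionIso`; transcribed
for good ordinary `p ≥ 5` in the Néron normalisation); `h5` — the period unit `Ω_E = u·Ω⁺_f`, `‖u‖_p = 1`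
(`realPeriodRat_eq_unit_mul_plusPeriod`); `hlev` — Carayol, `N = N_E` (`IsNewformOf.level_eq_conductorNorm`).
Proof: crux certificate for `(W, f)` ⟹ Néron-shape certificate at level `N_W` (`‖ϖ‖_p = 1`, newform
uniqueness — the argument of `neronCertificate_of_certificate`, file `…MuTransferX9CMPartnered`, inlined) ⟹ [EPW, `W → W'`] Néron-shape
certificate for `W'` ⟹ crux certificate for `(W', f')`: take `ϖ' = u'⁻¹` from `h5` (`‖ϖ'‖_p = 1`,
`norm_periodRatio_eq_one`) and `f'` at level `N_{W'}` (`hlev`).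

What this is NOT: not a proof of any `μ = 0`; not a booking; EPW's theorem is cited, not proved.
[cite: EmertonPollackWeston2006, Thm. 1 (arXiv:math/0404484 p. 2)]
[cite: GreenbergVatsal2000, §3 Remark (3.4)]
-/

-- the summit and its single problem are both named `BirchSwinnertonDyer` (registry layout D-0017)
set_option linter.dupNamespace false

set_option autoImplicit false

noncomputable section

open scoped Classical MatrixGroups ModularForm

open CongruenceSubgroup WeierstrassCurve Field
open Literature.NumberTheory.EllipticCurves Literature.NumberTheory.EllipticCurves.ModularForms
open Literature.NumberTheory.EllipticCurves.Rank1Residual (norm_periodRatio_eq_one)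

namespace Summit.BirchSwinnertonDyer.BirchSwinnertonDyer.Rank1Residual

/-- **The crux certificate is a `ρ̄`-invariant (good ordinary `p ≥ 5`, `E[p]` irreducible), modulo
Emerton–Pollack–Weston Thm. 1, the period unit and Carayol.** For globally minimal `W, W'` over `ℚ`,
`5 ≤ p` good ordinary for both, `W[p]` irreducible, a `Γ_ℚ`-equivariant `W[p] ≃ W'[p]`, newforms `f` of
`W` and `f'` of `W'` (any levels): a unit coefficient of `L_p(f, α_W)` gives a unit coefficient of
`L_p(f', α_{W'})`. [cite: EmertonPollackWeston2006, Thm. 1 (arXiv:math/0404484 p. 2)]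
[cite: GreenbergVatsal2000, §3 Remark (3.4)] -/
theorem certificate_of_torsionIso
    (hEPW : EmertonPollackWeston2006.thm1_muAn_transfer_of_torsionIso)
    (h5 : realPeriodRat_eq_unit_mul_plusPeriod)
    (hlev : ∀ (N : ℕ) [NeZero N], IsNewformOf.level_eq_conductorNorm (N := N))
    (W W' : WeierstrassCurve ℚ) [W.IsElliptic] [W.IsGloballyMinimal] [W'.IsElliptic]
    [W'.IsGloballyMinimal] (p : ℕ) [Fact p.Prime] (hp : 5 ≤ p)
    (hgood : W.HasGoodReductionAtPrime p) (hord : ¬ (p : ℤ) ∣ W.frobeniusTrace p)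
    (hirr : W.HasIrreducibleModPGaloisRep p)
    (hgood' : W'.HasGoodReductionAtPrime p) (hord' : ¬ (p : ℤ) ∣ W'.frobeniusTrace p)
    (hiso : ∃ e : geomTorsion W (p : ℤ) ≃+ geomTorsion W' (p : ℤ),
      ∀ (σ : Field.absoluteGaloisGroup ℚ) (P : geomTorsion W (p : ℤ)), e (σ • P) = σ • e P)
    {N : ℕ} [NeZero N] (f : CuspForm (Gamma0 N) 2) (hf : IsNewformOf W f)
    {N' : ℕ} [NeZero N'] (f' : CuspForm (Gamma0 N') 2) (hf' : IsNewformOf W' f')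
    (hcert : ∃ n : ℕ, ‖PowerSeries.coeff n (padicLFunction f (unitRoot W p : ℚ_[p]))‖ = 1) :
    ∃ n : ℕ, ‖PowerSeries.coeff n (padicLFunction f' (unitRoot W' p : ℚ_[p]))‖ = 1 := by
  -- irreducibility of `W'[p]`, transported along the isomorphism
  obtain ⟨e, he⟩ := hiso
  have hirr' : W'.HasIrreducibleModPGaloisRep p :=
    GreenbergVatsal2000.hasIrreducibleModPGaloisRep_of_torsionIso e he hirr
  -- the certificate of `W` in the Néron shape (`‖ϖ₁‖_p = 1`, newform uniqueness; as in
  -- `neronCertificate_of_certificate` of `…MuTransferX9CMPartnered`), transported to `W'` by EPW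
  have hμW : ∀ [NeZero (W.conductorNorm ℤ)] (f₁ : CuspForm (Gamma0 (W.conductorNorm ℤ)) 2),
      IsNewformOf W f₁ → ∀ (ϖ₁ : ℚ), (ϖ₁ : ℝ) * W.realPeriodRat = plusPeriod f₁ →
      ∃ n : ℕ, ‖PowerSeries.coeff n
        (PowerSeries.C (ϖ₁ : ℚ_[p]) * padicLFunction f₁ (unitRoot W p : ℚ_[p]))‖ = 1 := by
    intro _ f₁ hf₁ ϖ₁ hϖ₁
    have hϖ₁norm : ‖(ϖ₁ : ℚ_[p])‖ = 1 := norm_periodRatio_eq_one h5 W p hp hgood hirr f₁ hf₁ ϖ₁ hϖ₁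
    obtain ⟨n, hn⟩ := exists_norm_coeff_eq_one_of_isNewformOf hlev hf₁ hf _ hcert
    exact ⟨n, by rw [PowerSeries.coeff_C_mul, norm_mul, hϖ₁norm, one_mul, hn]⟩
  -- read it on `f'` at level `N_{W'}` (Carayol) with the period ratio `ϖ' = u⁻¹`
  obtain rfl : N' = W'.conductorNorm ℤ := hlev N' hf'
  have hμW' := hEPW W W' p hp hgood hord hgood' hord' ⟨e, he⟩ hirr
    (fun f₁ hf₁ ϖ₁ hϖ₁ => hμW f₁ hf₁ ϖ₁ hϖ₁)
  obtain ⟨u, hu1, hu⟩ := h5 W' p hp hgood' hirr' f' hf'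
  have hu0 : u ≠ 0 := by
    rintro rfl
    simp at hu1
  have hϖ : ((u⁻¹ : ℚ) : ℝ) * W'.realPeriodRat = plusPeriod f' := by
    rw [hu]
    push_cast
    field_simp
  have hϖnorm : ‖((u⁻¹ : ℚ) : ℚ_[p])‖ = 1 :=
    norm_periodRatio_eq_one h5 W' p hp hgood' hirr' f' hf' u⁻¹ hϖ
  obtain ⟨n, hn⟩ := hμW' f' hf' u⁻¹ hϖ
  refine ⟨n, ?_⟩
  rw [PowerSeries.coeff_C_mul, norm_mul, hϖnorm, one_mul] at hn
  exact hn

/-- **On class X9 the analytic `μ = 0` input is decided per mod-`p` congruence class.** For two X9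
pairs `(W, p)`, `(W', p)` (`Rank1Residual.ClassX9`) with a `Γ_ℚ`-equivariant `W[p] ≃ W'[p]`: if every
newform of `W` carries the unit-coefficient certificate (the conclusion of `AnalyticMuZeroOnClassX9` at
`(W, p)`), so does every newform of `W'` — modulo EPW Thm. 1 (`hEPW`), the period unit (`h5`), Carayol
(`hlev`) and modularity (`hmodP`, to have a newform of `W` at hand; all four are cite-only facts of the
K6 cone). One exact modular-symbol certificate per `ρ̄` thus serves the whole congruence class ∩ X9
(judge note (d): "per-`ρ̄` deletions bankable"). [cite: EmertonPollackWeston2006, Thm. 1 (arXiv:math/0404484 p. 2)] -/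
theorem analyticCertificate_classX9_of_torsionIso
    (hEPW : EmertonPollackWeston2006.thm1_muAn_transfer_of_torsionIso)
    (h5 : realPeriodRat_eq_unit_mul_plusPeriod)
    (hlev : ∀ (N : ℕ) [NeZero N], IsNewformOf.level_eq_conductorNorm (N := N))
    (hmodP : nonempty_modularParametrizationData)
    (W W' : WeierstrassCurve ℚ) [W.IsElliptic] [W.IsGloballyMinimal] [W'.IsElliptic]
    [W'.IsGloballyMinimal] (p : ℕ) [Fact p.Prime] (hX9 : ClassX9 W p) (hX9' : ClassX9 W' p)
    (hiso : ∃ e : geomTorsion W (p : ℤ) ≃+ geomTorsion W' (p : ℤ),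
      ∀ (σ : Field.absoluteGaloisGroup ℚ) (P : geomTorsion W (p : ℤ)), e (σ • P) = σ • e P)
    (hcert : ∀ {N : ℕ} [NeZero N] (f : CuspForm (Gamma0 N) 2), IsNewformOf W f →
      ∃ n : ℕ, ‖PowerSeries.coeff n (padicLFunction f (unitRoot W p : ℚ_[p]))‖ = 1)
    {N' : ℕ} [NeZero N'] (f' : CuspForm (Gamma0 N') 2) (hf' : IsNewformOf W' f') :
    ∃ n : ℕ, ‖PowerSeries.coeff n (padicLFunction f' (unitRoot W' p : ℚ_[p]))‖ = 1 := by
  obtain ⟨-, hp, hgood, hord, hirr, -⟩ := hX9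
  obtain ⟨-, -, hgood', hord', -, -⟩ := hX9'
  -- a newform of `W` (modularity), at which the universal certificate is read
  haveI : NeZero (W.conductorNorm ℤ) := ⟨(W.conductorNorm_pos_holds).ne'⟩
  obtain ⟨Dm⟩ := hmodP W
  exact certificate_of_torsionIso hEPW h5 hlev W W' p hp hgood hord hirr hgood' hord' hiso Dm.f
    Dm.isNewformOf f' hf' (hcert Dm.f Dm.isNewformOf)

end Summit.BirchSwinnertonDyer.BirchSwinnertonDyer.Rank1Residual

end
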